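import Summits.AtomisticToContinuum.Crystallization.Theorems.FrustratedLawDichotomyLocalCloseOrderFinite
import Summits.AtomisticToContinuum.Crystallization.Theorems.FrustratedLawDichotomyLocalCloseOrder
import Summits.AtomisticToContinuum.Crystallization.Theorems.FrustratedLawDichotomyRangeCut

/-!
# FrustratedLawDichotomy · crux `AperiodicFrustratedLawGap` (stmt-AtomisticToContinuum-27623) — THE EXEMPTION DOOR:
# every site predicate that is ABSENT DEEP INSIDE windows of an exact μ-equilibrium may be REFUNDED at an arbitrary rate
# (decomp-a2c, prover hand 2, structural share, generation 14; generic, radius-free)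

The door of record feeds the crux through the finite statement `FDG` (`FrustratedLawDichotomyRangeCut.FDG`): some `κ > 0`, `C`
price EVERY finite injective `7/10`-separated cluster `y` by `κ·N − C·#{1/20-good sites} ≤ U(y) − N·e⋆`.  Its proof
(`FrustratedLawDichotomyLocalCloseOrderFinite.localCloseOrder_of_frustrationDensityGap`) applies the price only to ROOT-CENTRED WINDOWS
`X ∩ B̄(0,r)` of a rooted `7/10`-separated `e⋆`-μGSC `X` (thin-shell balls of item 27625), where the `1/20`-good sites are confined to
the shell because `X` has none.  The refund mechanism is therefore not specific to goodness: ANY site predicate `Ex` which no site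
DEEPER THAN SOME FIXED `M` inside such a window can satisfy («deep-absent», `DeepAbsent M Ex`) is confined to the shell as well, and the
same chain `κ·n − C·#shell ≤ U − n·e⋆ ≤ −I(C, X∖C) ≤ n·T(L) + #shell·T(7/10)` closes.

* `DeepAbsent M Ex`     — in every window `xf` (`range xf = X ∩ B̄(0,r)`) of a rooted `7/10`-separated `e⋆`-μGSC `X` of `V_LJ`, every
                          site with `‖xf i‖ + M ≤ r` fails `Ex`;
* `ExemptFDG Ex`        — «some `κ > 0`, `C` price every finite injective `7/10`-separated `y` by
                          `κ·N − C·#{i : GoodAt (1/20) y i ∨ Ex y i} ≤ U(y) − N·e⋆`» (the exempt sites are FREE: `C` is arbitrary);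
* `localCloseOrder_of_exemptFDG : DeepAbsent M Ex → ExemptFDG Ex → LCO` (text of `FrustratedLawDichotomyLocalCloseOrder` verbatim),
  hence the crux / the sibling `PeriodicFrustratedLawGap` / the REGISTERED STUB `stub_aperiodicErgodicGap` BY NAME granted
  `MuEquilibriumDoor` (`aperiodicFrustratedLawGap_of_exemptFDG`, `periodicFrustratedLawGap_of_exemptFDG`, `aperiodicErgodicGap_of_exemptFDG`);
* bookkeeping: `exemptFDG_of_fdg` (`FDG` is the case `Ex = ⊥`, and implies every `ExemptFDG Ex`), `DeepAbsent.mono`, `DeepAbsent.or`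
  (exemptions COMBINE: finitely many deep-absent predicates are jointly deep-absent), `deepAbsent_bot`.

WHY (critic rows 526 (iii) / 527): every local certificate beneath the energetic residual `T′♭₄₅` is attacked by `7/10`-legal but
energetically absurd textures (the hedgehog's over-packed shell, compressed platelets, density steps); under this door such sites need
not be priced at all once they are recognised by a deep-absent LOCAL test.  Two such tests, both consequences of Sütő's μ-equilibrium
alone and both checkable on a motif by interval arithmetic, are supplied in the sequel files: REMOVAL instability
(`siteEnergy V_LJ y i > eUp + t`: a deep atom of an `e⋆`-μGSC is bound by at least `−e⋆ ≥ −eUp`, `IsMuGSC.removal` with `n = 1`) and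
ONE-MOVE instability (moving the atom within `s` lowers its own cluster site energy by more than `t`: `IsMuGSC.exchange` with `n = k = 1`).
All `[folklore]` bookkeeping on landed lemmas; the thin-shell / deep-transfer / cluster-exactness steps are those of generation 7 verbatim.
-/

noncomputable section

namespace Summit.AtomisticToContinuum.Crystallization.Theorems.FrustratedLawDichotomyExemptDoor

open Filter Topology Metric
open Literature.MathematicalPhysics.StatisticalMechanics
open Literature.Geometry.DiscreteGeometry
open Summit.AtomisticToContinuum.Crystallization.Theorems.ChargedEnergyGapNegative (E3 eStar)
open Summit.AtomisticToContinuum.Crystallization.Theorems.FrustratedLawDichotomyGSCClusterExactness (excess_le_neg_cross)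
open Summit.AtomisticToContinuum.Crystallization.Theorems.FrustratedLawDichotomyGSCVanHoveBalls (abs_cross_le_of_ball tail_antitone)
open Summit.AtomisticToContinuum.Crystallization.Theorems.FrustratedLawDichotomyFolnerRadius (stub_folnerRadius)
open Summit.AtomisticToContinuum.Crystallization.Theorems.FrustratedLawDichotomyLocalCloseOrderFinite
  (exists_near_of_isMuGSC exists_thinShell_ball robustGood_of_deep)
open Summit.AtomisticToContinuum.Crystallization.Theorems.FrustratedLawDichotomyLocalCloseOrder
  (aperiodicFrustratedLawGap_of_localCloseOrder periodicFrustratedLawGap_of_localCloseOrder aperiodicErgodicGap_of_localCloseOrder)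
open Summit.AtomisticToContinuum.Crystallization.Theorems.FrustratedLawDichotomyRangeCut (Sep GoodAt goodCount FDG)

/-! ## §1. Site predicates, deep absence, the exempt price -/

/-- A **site predicate** on finite clusters: `Ex N y i` is a property of the site `i` of the cluster `y : Fin N → ℝ³`. -/
abbrev SitePred : Type := (N : ℕ) → (Fin N → EuclideanSpace ℝ (Fin 3)) → Fin N → Prop

/-- **DEEP ABSENCE at depth `M`**: in every root-centred WINDOW `xf` (injective, `range xf = X ∩ B̄(0, r)`) of a rooted `7/10`-separated
`e⋆`-μGSC `X` of `V_LJ`, no site deeper than `M` inside the window (`‖xf i‖ + M ≤ r`) satisfies `Ex`. -/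
def DeepAbsent (M : ℝ) (Ex : SitePred) : Prop :=
  ∀ X : Set (EuclideanSpace ℝ (Fin 3)), (0 : EuclideanSpace ℝ (Fin 3)) ∈ X →
    (∀ a ∈ X, ∀ b ∈ X, a ≠ b → (7 : ℝ) / 10 ≤ dist a b) → IsMuGSC lennardJones eStar X →
    ∀ (r : ℝ) (n : ℕ) (xf : Fin n → EuclideanSpace ℝ (Fin 3)), Function.Injective xf →
      Set.range xf = X ∩ closedBall 0 r → ∀ i : Fin n, ‖xf i‖ + M ≤ r → ¬ Ex n xf i

/-- **THE EXEMPT FRUSTRATION DENSITY GAP `ExemptFDG Ex`**: some `κ > 0` and `C` price every finite injective `7/10`-separated cluster by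
`κ·N − C·#{i : GoodAt (1/20) y i ∨ Ex y i} ≤ U(y) − N·e⋆` — the `1/20`-good sites AND the `Ex`-sites are refunded at rate `C`. -/
def ExemptFDG (Ex : SitePred) : Prop :=
  ∃ κ : ℝ, 0 < κ ∧ ∃ C : ℝ, ∀ (N : ℕ) (y : Fin N → EuclideanSpace ℝ (Fin 3)), Function.Injective y → Sep y →
    κ * N - C * (Nat.card {i : Fin N // GoodAt (1 / 20) y i ∨ Ex N y i} : ℝ) ≤
      interactionEnergy lennardJones y - N * eStar

/-! ## §2. Bookkeeping: monotonicity, combination, and `FDG` as the exemption-free case -/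

/-- Deep absence is monotone in the depth. [folklore] -/
theorem DeepAbsent.mono {M M' : ℝ} {Ex : SitePred} (h : DeepAbsent M Ex) (hM : M ≤ M') : DeepAbsent M' Ex :=
  fun X h0 hsep hG r n xf hxf hr i hi => h X h0 hsep hG r n xf hxf hr i (by linarith)

/-- Deep absence passes to weaker predicates. [folklore] -/
theorem DeepAbsent.of_imp {M : ℝ} {Ex Ex' : SitePred} (h : DeepAbsent M Ex)
    (himp : ∀ (N : ℕ) (y : Fin N → EuclideanSpace ℝ (Fin 3)) (i : Fin N), Ex' N y i → Ex N y i) : DeepAbsent M Ex' :=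
  fun X h0 hsep hG r n xf hxf hr i hi hEx' => h X h0 hsep hG r n xf hxf hr i hi (himp n xf i hEx')

/-- **Exemptions combine**: the disjunction of two deep-absent predicates is deep-absent (at the larger depth). [folklore] -/
theorem DeepAbsent.or {M₁ M₂ : ℝ} {Ex₁ Ex₂ : SitePred} (h₁ : DeepAbsent M₁ Ex₁) (h₂ : DeepAbsent M₂ Ex₂) :
    DeepAbsent (max M₁ M₂) (fun N y i => Ex₁ N y i ∨ Ex₂ N y i) := by
  intro X h0 hsep hG r n xf hxf hr i hi hEx
  rcases hEx with hE | hE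
  · exact h₁ X h0 hsep hG r n xf hxf hr i (by linarith [le_max_left M₁ M₂]) hE
  · exact h₂ X h0 hsep hG r n xf hxf hr i (by linarith [le_max_right M₁ M₂]) hE

/-- The empty predicate is deep-absent (at any depth). [folklore] -/
theorem deepAbsent_bot (M : ℝ) : DeepAbsent M (fun _ _ _ => False) :=
  fun _ _ _ _ _ _ _ _ _ _ _ h => h

/-- `ExemptFDG` is monotone in the predicate: exempting MORE sites is a weaker price (the rate is first made nonnegative). [folklore] -/
theorem ExemptFDG.of_imp {Ex Ex' : SitePred} (h : ExemptFDG Ex)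
    (himp : ∀ (N : ℕ) (y : Fin N → EuclideanSpace ℝ (Fin 3)) (i : Fin N), Ex N y i → Ex' N y i) : ExemptFDG Ex' := by
  classical
  obtain ⟨κ, hκ, C, hC⟩ := h
  refine ⟨κ, hκ, max C 0, fun N y hy hsep => ?_⟩
  have h1 := hC N y hy hsep
  have hle : (Nat.card {i : Fin N // GoodAt (1 / 20) y i ∨ Ex N y i} : ℝ) ≤
      Nat.card {i : Fin N // GoodAt (1 / 20) y i ∨ Ex' N y i} := by
    exact_mod_cast Nat.card_le_card_of_injective
      (fun i : {i : Fin N // GoodAt (1 / 20) y i ∨ Ex N y i} =>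
        (⟨i.1, i.2.imp_right (himp N y i.1)⟩ : {i : Fin N // GoodAt (1 / 20) y i ∨ Ex' N y i}))
      fun a b hab => Subtype.ext (by simpa using congrArg Subtype.val hab)
  have hg0 : (0 : ℝ) ≤ Nat.card {i : Fin N // GoodAt (1 / 20) y i ∨ Ex N y i} := Nat.cast_nonneg _
  have hC0 : (0 : ℝ) ≤ max C 0 := le_max_right _ _
  have hCC : C ≤ max C 0 := le_max_left _ _
  nlinarith [mul_le_mul_of_nonneg_left hle hC0, mul_le_mul_of_nonneg_right hCC hg0]

/-- **`FDG ⟹ ExemptFDG Ex` for every predicate** (`FDG` refunds the good sites only). [folklore] -/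
theorem exemptFDG_of_fdg (hFDG : FDG) (Ex : SitePred) : ExemptFDG Ex := by
  classical
  obtain ⟨κ, hκ, C, hC⟩ := hFDG
  have h0 : ExemptFDG (fun _ _ _ => False) := by
    refine ⟨κ, hκ, C, fun N y hy hsep => ?_⟩
    have h1 := hC N y hy hsep
    have heq : (Nat.card {i : Fin N // GoodAt (1 / 20) y i ∨ False} : ℝ) = goodCount (1 / 20) y := by
      simp only [or_false]
      rfl
    rw [heq]
    exact h1
  exact h0.of_imp fun _ _ _ h => h.elim

/-! ## §3. `DeepAbsent M Ex → ExemptFDG Ex → LCO` -/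

/-- **THE EXEMPTION DOOR**: if `Ex` is deep-absent at some depth `M` and the exempt price `ExemptFDG Ex` holds, then every rooted
`7/10`-separated `e⋆`-μGSC of `V_LJ` has a robustly good atom (`LCO`, text of `FrustratedLawDichotomyLocalCloseOrder` VERBATIM).
Proof = generation 7's `localCloseOrder_of_frustrationDensityGap` with the shell thickness also `≥ M`: good sites of the window are in
the shell by deep transfer, `Ex`-sites by deep absence. [folklore] -/
theorem localCloseOrder_of_exemptFDG {M : ℝ} {Ex : SitePred} (hEx : DeepAbsent M Ex) (hFDG : ExemptFDG Ex) :
    ∀ X : Set (EuclideanSpace ℝ (Fin 3)), (0 : EuclideanSpace ℝ (Fin 3)) ∈ X → (∀ a ∈ X, ∀ b ∈ X, a ≠ b → (7 : ℝ) / 10 ≤ dist a b) → Literature.MathematicalPhysics.StatisticalMechanics.IsMuGSC Literature.MathematicalPhysics.StatisticalMechanics.lennardJones (⨅ Q : Literature.MathematicalPhysics.StatisticalMechanics.PeriodicConfiguration 3, Q.energyPerParticle Literature.MathematicalPhysics.StatisticalMechanics.lennardJones) X → ∃ p : EuclideanSpace ℝ (Fin 3), p ∈ X ∧ ∃ (d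 η γ : ℝ) (A : EuclideanSpace ℝ (Fin 3) →ₗᵢ[ℝ] EuclideanSpace ℝ (Fin 3)), (∃ t : ↥Literature.Geometry.DiscreteGeometry.fccKissingPattern → EuclideanSpace ℝ (Fin 3), 0 < d ∧ 0 < γ ∧ η < 1 / 20 ∧ (∀ u : ↥Literature.Geometry.DiscreteGeometry.fccKissingPattern, t u ∈ X ∧ ‖(t u - p) - d • A (u : EuclideanSpace ℝ (Fin 3))‖ ≤ η * d) ∧ (∀ s : EuclideanSpace ℝ (Fin 3), s ∈ X → s ≠ p → d ≤ dist s p) ∧ (∃ s : EuclideanSpace ℝ (Fin 3), s ∈ X ∧ s ≠ p ∧ dist s p ≤ d) ∧ (∀ s : EuclideanSpace ℝ (Fin 3), s ∈ X → s ≠ p → dist s p < 13 / 10 * d + γ → dist s p ≤ 13 / 10 * d - γ ∧ s ∈ Set.range t)) ∨ (∃ t : ↥Literature.Geometry.DiscreteGeometry.hcpKissingPattern → EuclideanSpace ℝ (Fin 3), 0 < d ∧ 0 < γ ∧ η < 1 / 20 ∧ (∀ u : ↥Literature.Geometry.DiscreteGeometry.hcpKissingPattern, t u ∈ X ∧ ‖(t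 u - p) - d • A (u : EuclideanSpace ℝ (Fin 3))‖ ≤ η * d) ∧ (∀ s : EuclideanSpace ℝ (Fin 3), s ∈ X → s ≠ p → d ≤ dist s p) ∧ (∃ s : EuclideanSpace ℝ (Fin 3), s ∈ X ∧ s ≠ p ∧ dist s p ≤ d) ∧ (∀ s : EuclideanSpace ℝ (Fin 3), s ∈ X → s ≠ p → dist s p < 13 / 10 * d + γ → dist s p ≤ 13 / 10 * d - γ ∧ s ∈ Set.range t)) := by
  classical
  obtain ⟨κ, hκ, C, hF⟩ := hFDG
  intro X h0 hsep hGSC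
  by_contra hno
  -- the Følner radii (item 27625, landed)
  obtain ⟨Ls, εs, hLs, hεs, hFol⟩ := stub_folnerRadius (7 / 10) (by norm_num)
  -- constants, introduced by equations
  obtain ⟨K, hK⟩ : ∃ K : ℝ, K = (7 / 10 : ℝ)⁻¹ ^ 6 / 12 + 1 / 6 := ⟨_, rfl⟩
  have hKpos : 0 < K := by rw [hK]; positivity
  obtain ⟨T₀, hT₀def⟩ : ∃ T₀ : ℝ, T₀ = K * (1024 / ((7 / 10 : ℝ) ^ 3 * (7 / 10 : ℝ) ^ 3)) := ⟨_, rfl⟩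
  have hT₀ : 0 ≤ T₀ := by rw [hT₀def]; positivity
  obtain ⟨C', hC'def⟩ : ∃ C' : ℝ, C' = max C 0 := ⟨_, rfl⟩
  have hC'0 : 0 ≤ C' := by rw [hC'def]; exact le_max_right _ _
  have hCC' : C ≤ C' := by rw [hC'def]; exact le_max_left _ _
  obtain ⟨M₀, hM₀def⟩ : ∃ M₀ : ℝ, M₀ = max (max 66 M) (4 * K * 1024 / ((7 / 10 : ℝ) ^ 3 * κ)) := ⟨_, rfl⟩
  have hM₀66 : (66 : ℝ) ≤ M₀ := by rw [hM₀def]; exact (le_max_left _ _).trans (le_max_left _ _)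
  have hM₀M : M ≤ M₀ := by rw [hM₀def]; exact (le_max_right _ _).trans (le_max_left _ _)
  have hM₀κ : 4 * K * 1024 / ((7 / 10 : ℝ) ^ 3 * κ) ≤ M₀ := by rw [hM₀def]; exact le_max_right _ _
  have hM₀pos : 0 < M₀ := by linarith
  -- choose the scale `R`: thick shell `Ls R ≥ M₀`, small shell fraction `εs R`
  have e1 : ∀ᶠ R in atTop, M₀ ≤ Ls R := hLs.eventually_ge_atTop M₀
  have hcpos : 0 < κ / (4 * (T₀ + C' + 1)) := by positivity
  have e2 : ∀ᶠ R in atTop, εs R < κ / (4 * (T₀ + C' + 1)) := (tendsto_order.1 hεs).2 _ hcpos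
  have e3 : ∀ᶠ R : ℝ in atTop, 0 ≤ R := eventually_ge_atTop 0
  obtain ⟨R, hR₁, hR₂, hR₃⟩ := (e1.and (e2.and e3)).exists
  -- the thin-shell ball at scale `R`
  obtain ⟨r, n, xf, -, hinj, hrange, hnpos, hshell⟩ :=
    exists_thinShell_ball (by norm_num : (0 : ℝ) < 7 / 10) hsep h0 hFol hR₃
  have hsub : Set.range xf ⊆ X := hrange.le.trans Set.inter_subset_left
  have hXC : ∀ s ∈ X, ‖s‖ ≤ r → s ∈ Set.range xf := fun s hs hsr => by
    rw [hrange]; exact ⟨hs, mem_closedBall_zero_iff.2 hsr⟩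
  have hnr : (0 : ℝ) < n := by exact_mod_cast hnpos
  -- (iv) cluster exactness and (ii) the cross bound
  have hex := excess_le_neg_cross hGSC hinj hsub
  have hI := abs_cross_le_of_ball (by norm_num : (0 : ℝ) < 7 / 10) hsep (r := r) (L := Ls R) hrange
  rw [← hK] at hI
  rw [← hT₀def] at hI
  have hnegI := neg_le_abs (∑ i, ∑' y : ↥(X \ Set.range xf), lennardJones (dist (xf i) y))
  -- the tail at thickness `Ls R` is at most `κ/4`
  have hLsR : M₀ ≤ max (Ls R) (7 / 10) := hR₁.trans (le_max_left _ _)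
  have hT₁ : K * (1024 / ((7 / 10 : ℝ) ^ 3 * (max (Ls R) (7 / 10)) ^ 3)) ≤ κ / 4 := by
    have h1 := tail_antitone (by norm_num : (0 : ℝ) < 7 / 10) hM₀pos hLsR
    rw [← hK] at h1
    have hM1 : (1 : ℝ) ≤ M₀ := by linarith
    have hsq : (1 : ℝ) ≤ M₀ * M₀ := by nlinarith
    have h3 : M₀ ≤ M₀ ^ 3 := by
      calc M₀ = M₀ * 1 := (mul_one _).symm
        _ ≤ M₀ * (M₀ * M₀) := mul_le_mul_of_nonneg_left hsq hM₀pos.le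
        _ = M₀ ^ 3 := by ring
    have h4 : K * (1024 / ((7 / 10 : ℝ) ^ 3 * M₀ ^ 3)) ≤ K * (1024 / ((7 / 10 : ℝ) ^ 3 * M₀)) := by
      refine mul_le_mul_of_nonneg_left ?_ hKpos.le
      exact div_le_div_of_nonneg_left (by norm_num) (by positivity) (mul_le_mul_of_nonneg_left h3 (by positivity))
    have h5 : K * (1024 / ((7 / 10 : ℝ) ^ 3 * M₀)) ≤ κ / 4 := by
      have h2' : 4 * K * 1024 ≤ M₀ * ((7 / 10 : ℝ) ^ 3 * κ) := (div_le_iff₀ (by positivity)).1 hM₀κ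
      rw [mul_div_assoc', div_le_iff₀ (by positivity)]
      linarith
    linarith
  -- (iii) every refunded site of the window lies in the shell: good sites by deep transfer, `Ex`-sites by deep absence
  have hgood_shell : ∀ i : Fin n, (GoodAt (1 / 20) xf i ∨ Ex n xf i) → r - Ls R < ‖xf i‖ := by
    intro i hi
    by_contra hdeep
    rw [not_lt] at hdeep
    have hLs66 : (66 : ℝ) ≤ Ls R := hM₀66.trans hR₁
    have hLsM : M ≤ Ls R := hM₀M.trans hR₁
    rcases hi with hgood | hExi
    · obtain ⟨q, hqX, hqp, hqd⟩ := exists_near_of_isMuGSC hsep hGSC (hsub ⟨i, rfl⟩)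
      have hqC : q ∈ Set.range xf := by
        refine hXC q hqX ?_
        have h1 : ‖q‖ ≤ ‖xf i‖ + dist q (xf i) := by
          rw [dist_eq_norm]
          have := norm_add_le (xf i) (q - xf i)
          rwa [add_sub_cancel] at this
        linarith
      apply hno
      unfold GoodAt at hgood
      obtain ⟨d, η, γ, A, hgood⟩ := hgood
      rcases hgood with ⟨t, hg⟩ | ⟨t, hg⟩
      · have hd50 : d ≤ 50 := (hg.2.2.2.2.1 q hqC hqp).trans hqd.le
        have hdeep' : ‖xf i‖ + 13 / 10 * d + min γ 1 ≤ r := by linarith [min_le_right γ 1]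
        exact ⟨xf i, hsub ⟨i, rfl⟩, d, η, min γ 1, A, Or.inl ⟨t, robustGood_of_deep hsub hXC hg hdeep'⟩⟩
      · have hd50 : d ≤ 50 := (hg.2.2.2.2.1 q hqC hqp).trans hqd.le
        have hdeep' : ‖xf i‖ + 13 / 10 * d + min γ 1 ≤ r := by linarith [min_le_right γ 1]
        exact ⟨xf i, hsub ⟨i, rfl⟩, d, η, min γ 1, A, Or.inr ⟨t, robustGood_of_deep hsub hXC hg hdeep'⟩⟩
    · exact hEx X h0 hsep hGSC r n xf hinj hrange i (by linarith) hExi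
  have hcount : (Nat.card {i : Fin n // GoodAt (1 / 20) xf i ∨ Ex n xf i} : ℝ) ≤
      ((Finset.univ.filter fun m : Fin n => r - Ls R < ‖xf m‖).card : ℝ) := by
    rw [Nat.card_eq_fintype_card, Fintype.card_subtype]
    exact_mod_cast Finset.card_le_card (Finset.monotone_filter_right _ fun i _ hi => hgood_shell i hi)
  -- the price inequality on the cluster
  have hprice : κ * (n : ℝ) - C * (Nat.card {i : Fin n // GoodAt (1 / 20) xf i ∨ Ex n xf i} : ℝ) ≤
      interactionEnergy lennardJones xf - (n : ℝ) * eStar :=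
    hF n xf hinj fun a b hab => hsep (xf a) (hsub ⟨a, rfl⟩) (xf b) (hsub ⟨b, rfl⟩) fun h => hab (hinj h)
  -- abstract the real quantities
  generalize hgdef : (Nat.card {i : Fin n // GoodAt (1 / 20) xf i ∨ Ex n xf i} : ℝ) = g at hprice hcount
  generalize hUdef : interactionEnergy lennardJones xf = U at hprice hex
  generalize hIdef : (∑ i, ∑' y : ↥(X \ Set.range xf), lennardJones (dist (xf i) y)) = I at hex hI hnegI
  generalize hTdef : K * (1024 / ((7 / 10 : ℝ) ^ 3 * (max (Ls R) (7 / 10)) ^ 3)) = T₁ at hI hT₁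
  generalize hsdef : ((Finset.univ.filter fun m : Fin n => r - Ls R < ‖xf m‖).card : ℝ) = s at hI hcount hshell
  generalize hεdef : εs R = ε at hshell hR₂
  have hg0 : 0 ≤ g := by rw [← hgdef]; exact Nat.cast_nonneg _
  have hs0 : 0 ≤ s := by rw [← hsdef]; exact Nat.cast_nonneg _
  -- chain: κ·n − C·g ≤ U − n·e⋆ ≤ −I ≤ |I| ≤ n·T₁ + s·T₀
  have h1 : C * g ≤ C' * s := by
    nlinarith [mul_nonneg hC'0 (sub_nonneg.2 hcount), mul_nonneg (sub_nonneg.2 hCC') hg0]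
  have h2 : (n : ℝ) * T₁ ≤ n * (κ / 4) := mul_le_mul_of_nonneg_left hT₁ hnr.le
  have hTC : 0 ≤ T₀ + C' := add_nonneg hT₀ hC'0
  have h3 : s * (T₀ + C') ≤ ε * n * (T₀ + C') := mul_le_mul_of_nonneg_right hshell hTC
  have hεb : ε * (T₀ + C') ≤ κ / 4 := by
    by_cases hε0 : 0 ≤ ε
    · have h4 : ε * (T₀ + C') ≤ ε * (T₀ + C' + 1) := mul_le_mul_of_nonneg_left (by linarith) hε0
      have h5 : ε * (T₀ + C' + 1) ≤ κ / (4 * (T₀ + C' + 1)) * (T₀ + C' + 1) :=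
        mul_le_mul_of_nonneg_right hR₂.le (by positivity)
      have h6 : κ / (4 * (T₀ + C' + 1)) * (T₀ + C' + 1) = κ / 4 := by
        field_simp
      linarith
    · rw [not_le] at hε0
      have : ε * (T₀ + C') ≤ 0 := mul_nonpos_of_nonpos_of_nonneg hε0.le hTC
      linarith
  have h4 : ε * n * (T₀ + C') ≤ n * (κ / 4) := by
    have := mul_le_mul_of_nonneg_left hεb hnr.le
    linarith
  have key : κ * n ≤ n * (κ / 4) + n * (κ / 4) := by linarith
  have : κ * n ≤ 0 := by linarith
  exact absurd this (not_le.2 (mul_pos hκ hnr))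

/-! ## §4. The crux, the sibling and the registered stub BY NAME -/

/-- **`AperiodicFrustratedLawGap` (crux of item 27623) BY NAME from an exempt price**, granted `MuEquilibriumDoor` (item 27073):
`MuEquilibriumDoor ∧ DeepAbsent M Ex ∧ ExemptFDG Ex ⟹` crux. [folklore] -/
theorem aperiodicFrustratedLawGap_of_exemptFDG
    (hDoor : Summit.AtomisticToContinuum.Crystallization.Theses.GrainCoreNetworkSplit.MuEquilibriumDoor)
    {M : ℝ} {Ex : SitePred} (hEx : DeepAbsent M Ex) (hFDG : ExemptFDG Ex) :
    Summit.AtomisticToContinuum.Crystallization.Theses.FrustratedLawDichotomy.AperiodicFrustratedLawGap :=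
  aperiodicFrustratedLawGap_of_localCloseOrder hDoor (localCloseOrder_of_exemptFDG hEx hFDG)

/-- **`PeriodicFrustratedLawGap` (sibling crux, item 27624) BY NAME from an exempt price**, granted `MuEquilibriumDoor`. [folklore] -/
theorem periodicFrustratedLawGap_of_exemptFDG
    (hDoor : Summit.AtomisticToContinuum.Crystallization.Theses.GrainCoreNetworkSplit.MuEquilibriumDoor)
    {M : ℝ} {Ex : SitePred} (hEx : DeepAbsent M Ex) (hFDG : ExemptFDG Ex) :
    Summit.AtomisticToContinuum.Crystallization.Theses.FrustratedLawDichotomy.PeriodicFrustratedLawGap :=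
  periodicFrustratedLawGap_of_localCloseOrder hDoor (localCloseOrder_of_exemptFDG hEx hFDG)

/-- **THE REGISTERED STUB `stub_aperiodicErgodicGap`** (skeleton dd3251ad of item 27623, text VERBATIM via
`aperiodicErgodicGap_of_localCloseOrder`) from an exempt price, granted `MuEquilibriumDoor`. [folklore] -/
theorem aperiodicErgodicGap_of_exemptFDG
    (hDoor : Summit.AtomisticToContinuum.Crystallization.Theses.GrainCoreNetworkSplit.MuEquilibriumDoor)
    {M : ℝ} {Ex : SitePred} (hEx : DeepAbsent M Ex) (hFDG : ExemptFDG Ex) :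
    ∀ δ : ℝ, 0 < δ → ∀ P : MeasureTheory.Measure (MeasureTheory.Measure (EuclideanSpace ℝ (Fin 3))), let Gy : ℝ → (N : ℕ) → (Fin N → EuclideanSpace ℝ (Fin 3)) → Fin N → Prop := fun η N y j => let d : ℝ := sInf ((fun z => dist z (y (j : Fin N))) '' (Set.range (y) \ {(y (j : Fin N))})); let T : Set (EuclideanSpace ℝ (Fin 3)) := {z : EuclideanSpace ℝ (Fin 3) | z ∈ Set.range (y) ∧ z ≠ (y (j : Fin N)) ∧ dist z (y (j : Fin N)) < 13 / 10 * d}; ∃ A : EuclideanSpace ℝ (Fin 3) →ₗᵢ[ℝ] EuclideanSpace ℝ (Fin 3), (∃ e : ↥T ≃ ↥Literature.Geometry.DiscreteGeometry.fccKissingPattern, ∀ t : ↥T, dist (d⁻¹ • ((t : EuclideanSpace ℝ (Fin 3)) - (y (j : Fin N)))) (A ((e t : ↥Literature.Geometry.DiscreteGeometry.fccKissingPattern) : EuclideanSpace ℝ (Fin 3))) ≤ η) ∨ (∃ e : ↥T ≃ ↥Literature.Geometry.DiscreteGeometry.hcpKissingPattern, ∀ t : ↥T, dist (d⁻¹ •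 ((t : EuclideanSpace ℝ (Fin 3)) - (y (j : Fin N)))) (A ((e t : ↥Literature.Geometry.DiscreteGeometry.hcpKissingPattern) : EuclideanSpace ℝ (Fin 3))) ≤ η); let TexBall : (N : ℕ) → (Fin N → EuclideanSpace ℝ (Fin 3)) → Fin N → ℝ → ℝ → ℝ → ℝ → Prop := fun N y i R R₇ R₈ R₉ => (∀ a b : Fin N, a ≠ b → (7 : ℝ) / 10 ≤ dist (y a) (y b)) ∧ (∀ j : Fin N, dist (y j) (y i) ≤ R → ¬ Gy (1 / 20) N (y) j) ∧ (∀ j : Fin N, dist (y j) (y i) ≤ R → ¬ ((∀ j' : Fin N, dist (y j') (y j) ≤ R₇ → ¬ Gy (1 / 20) N (y) j') ∧ (∀ z : EuclideanSpace ℝ (Fin 3), dist z (y j) ≤ R₇ → ∃ k : Fin N, dist z (y k) ≤ 1) ∧ (∀ j' : Fin N, dist (y j') (y j) ≤ R₇ → (let d : ℝ := sInf ((fun z => dist z (y j')) '' (Set.range (y) \ {(y j')})); ∀ k : Fin N, y k ≠ y j' → dist (y k) (y j') < 27 / 20 * d → 5 ≤ Nat.card {m : Fin N // y m ≠ y j'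 ∧ dist (y m) (y j') < 27 / 20 * d ∧ y m ≠ y k ∧ dist (y m) (y k) < 27 / 20 * d})))) ∧ (∀ j : Fin N, dist (y j) (y i) ≤ R → ∃ k : Fin N, dist (y k) (y j) ≤ R₈ ∧ Gy (1 / 8) N (y) k) ∧ (∀ j : Fin N, dist (y j) (y i) ≤ R → ¬ ((∀ j' : Fin N, dist (y j') (y j) ≤ R₉ → ¬ Gy (1 / 20) N (y) j') ∧ (Nat.card {j' : Fin N // dist (y j') (y j) ≤ R₉ ∧ ¬ Gy (1 / 8) N (y) j'} : ℝ) ≤ 1 / 2 * (Nat.card {j' : Fin N // dist (y j') (y j) ≤ R₉} : ℝ) ∧ (∀ j' : Fin N, dist (y j') (y j) ≤ R₉ → ¬ Gy (1 / 8) N (y) j' → ¬ (let d : ℝ := sInf ((fun z => dist z (y j')) '' (Set.range (y) \ {(y j')})); ∀ k : Fin N, y k ≠ y j' → dist (y k) (y j') < 27 / 20 * d → 5 ≤ Nat.card {m : Fin N // y m ≠ y j' ∧ dist (y m) (y j') < 27 / 20 * d ∧ y m ≠ y k ∧ dist (y m) (y k) < 27 / 20 * d})))); let Appr : MeasureTheory.Measure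 (EuclideanSpace ℝ (Fin 3)) → ℝ → ℝ → ℝ → Prop := fun μ R₇ R₈ R₉ => ∀ q : EuclideanSpace ℝ (Fin 3), μ {q} ≠ 0 → ∀ R ε : ℝ, 0 < ε → ∃ (N : ℕ) (y : Fin N → EuclideanSpace ℝ (Fin 3)) (i : Fin N), TexBall N y i R R₇ R₈ R₉ ∧ (∀ p : EuclideanSpace ℝ (Fin 3), μ {p} ≠ 0 → dist p q ≤ R → ∃ k : Fin N, dist (y k - y i) (p - q) ≤ ε) ∧ (∀ k : Fin N, dist (y k) (y i) ≤ R → ∃ p : EuclideanSpace ℝ (Fin 3), μ {p} ≠ 0 ∧ dist (y k - y i) (p - q) ≤ ε); MeasureTheory.IsProbabilityMeasure P → (∀ᵐ μ ∂P, Literature.Probability.Process.IsRootedHardCore δ μ) → Literature.Probability.Process.IsPointStationaryLaw P → (∃ R₇ R₈ R₉ : ℝ, ∀ᵐ μ ∂P, Appr μ R₇ R₈ R₉) → (∀ᵐ μ ∂P, ∀ p : EuclideanSpace ℝ (Fin 3), μ {p} ≠ 0 → ∀ y : EuclideanSpace ℝ (Fin 3), (∀ q : EuclideanSpace ℝ (Fin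 3), μ {q} ≠ 0 → q ≠ p → y ≠ q) → ∑' q : {q : EuclideanSpace ℝ (Fin 3) // μ {q} ≠ 0 ∧ q ≠ p}, Literature.MathematicalPhysics.StatisticalMechanics.lennardJones (dist p (q : EuclideanSpace ℝ (Fin 3))) ≤ ∑' q : {q : EuclideanSpace ℝ (Fin 3) // μ {q} ≠ 0 ∧ q ≠ p}, Literature.MathematicalPhysics.StatisticalMechanics.lennardJones (dist y (q : EuclideanSpace ℝ (Fin 3)))) → P {μ : MeasureTheory.Measure (EuclideanSpace ℝ (Fin 3)) | ∃ Q : Literature.MathematicalPhysics.StatisticalMechanics.PeriodicConfiguration 3, ∃ t : EuclideanSpace ℝ (Fin 3), {p : EuclideanSpace ℝ (Fin 3) | μ {p} ≠ 0} = (fun s => s + t) '' Q.points} = 0 → (∀ A : Set (MeasureTheory.Measure (EuclideanSpace ℝ (Fin 3))), MeasurableSet A → (∀ μ : MeasureTheory.Measure (EuclideanSpace ℝ (Fin 3)), ∀ p : EuclideanSpace ℝ (Fin 3), μ {p} ≠ 0 → (μ ∈ A ↔ MeasureTheory.Measure.map (fun z : EuclideanSpace ℝ (Fin 3) => z - p)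 μ ∈ A)) → P A = 0 ∨ P Aᶜ = 0) → (⨅ Q : Literature.MathematicalPhysics.StatisticalMechanics.PeriodicConfiguration 3, Q.energyPerParticle Literature.MathematicalPhysics.StatisticalMechanics.lennardJones) < (∫ μ, Literature.MathematicalPhysics.StatisticalMechanics.rootEnergy Literature.MathematicalPhysics.StatisticalMechanics.lennardJones μ ∂P) :=
  aperiodicErgodicGap_of_localCloseOrder hDoor (localCloseOrder_of_exemptFDG hEx hFDG)

end Summit.AtomisticToContinuum.Crystallization.Theorems.FrustratedLawDichotomyExemptDoor

end
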